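import Mathlib.Topology.Sheaves.Flasque
import Mathlib.Topology.Sheaves.Abelian
import Mathlib.Topology.Sheaves.Stalks
import Mathlib.Topology.Sheaves.SheafCondition.UniqueGluing
import Mathlib.Topology.Sheaves.MayerVietoris
import Mathlib.Topology.Sets.Closeds
import Mathlib.CategoryTheory.Sites.SheafCohomology.Basic
import Mathlib.CategoryTheory.Abelian.GrothendieckCategory.HasExt
import Mathlib.CategoryTheory.Limits.Constructions.EpiMono
import Mathlib.CategoryTheory.Limits.FunctorCategory.EpiMono
import Mathlib.Algebra.Category.Grp.EpiMono
import Literature.AlgebraicGeometry.Motives.DirectedColimits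
import HarnessLib

/-!
# Sheaves of abelian groups supported on a closed subset; the sheaves `ℤ_{Y,U}`

Topic: `Literature/AlgebraicGeometry/Motives` (support file for `GrothendieckVanishing.lean`; the
elementary sheaf theory on a topological space `X` used in the proof of Grothendieck's vanishing
theorem, Hartshorne, *Algebraic Geometry*, III, Thm. 2.7, pp. 208–211, which argues by induction on
closed subsets `Y ⊆ X` with sheaves on `X` supported on `Y`).

Setting. `X : TopCat.{u}`; sheaves of abelian groups are the objects of the abelian category
`Sheaf (Opens.grothendieckTopology X) AddCommGrpCat.{u}` (definitionally `TopCat.Sheaf AddCommGrpCat X`).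
All sheaves below live on the fixed ambient space `X`; a closed subset `Y` enters only through support
conditions, which avoids pulling back to / pushing forward from the subspace `Y` (Hartshorne III.2.10).

Contents (all in `namespace Literature`):

* `Sheaf.injective_of_mono`, `Sheaf.isIso_of_bijective`,
  `Sheaf.isZero_of_sections`, `Sheaf.locally_surjective_of_epi`, `Sheaf.eq_zero_of_locally_eq_zero`:
  sectionwise criteria for mono/iso/zero and local surjectivity of epimorphisms.
* `IsSupportedOn F Y`: the sections of `F` over opens disjoint from `Y` vanish ("`F` is supported on
  `Y`", i.e. `F|_{X ∖ Y} = 0`; cf. Hartshorne II, Ex. 1.14 (support), Ex. 1.19–1.20); stable under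
  sub- and quotient sheaves; `IsSupportedOn.germ_eq_zero`; `IsSupportedOn.surjective_map_of_isClosed`:
  for `Y` closed, sections over `V` extend (by zero) to `V ∪ (X ∖ Y)`.
* `supportedPart G S` with its mono `supportedPartι : supportedPart G S ⟶ G`: the subsheaf of sections
  whose germs vanish at the points not in `S` (for `S` closed, Hartshorne's `ℋ⁰_S(G)`, II Ex. 1.20; it
  is used for the dévissage `0 → ℋ⁰_{Y₁}(G) → G → 𝒬 → 0` of Step 1 of the proof of III.2.7, with
  `isSupportedOn_supportedPart` and `surjective_supportedPartι_app_of_isSupportedOn` locating the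
  supports of the two ends).
* `constSub hY hU` (notation in docstrings: `ℤ_{Y,U}`), for `Y ⊆ X` preirreducible and `U` an open
  containing `X ∖ Y`: the sheaf with sections `ℤ` over the opens `V ⊆ U` meeting `Y` and `0`
  otherwise (`isSheaf_constSubPresheaf`). For `Y` closed irreducible this is the push-forward to `X` of
  Hartshorne's sheaf `ℤ_{U ∩ Y}` on the space `Y` (the constant sheaf `ℤ` on the open `U ∩ Y` of `Y`
  extended by zero, II Ex. 1.19), the building block of Steps 3–5 of the proof of III.2.7.
  API: `isSupportedOn_constSub`, `isFlasque_constSub_top` (`ℤ_{Y,X}` is flasque, cf. II Ex. 1.16(a)),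
  `isZero_constSub`, the inclusions `constSubι : ℤ_{Y,U} ⟶ ℤ_{Y,U'}` (`U ⊆ U'`, mono, with cokernel
  supported on `Y ∖ U`: `isSupportedOn_cokernel_constSubι`), and the morphisms
  `constSubDesc : ℤ_{Y,U} ⟶ G`, `1 ↦ s`, attached to sections `s ∈ G(U)` of a sheaf `G` supported on
  `Y` (`constSubDesc_app_one`).

## References

* R. Hartshorne, *Algebraic Geometry*, GTM 52, Springer (1977), doi:10.1007/978-1-4757-3849-0,
  II.1 (Ex. 1.14, 1.16, 1.19, 1.20, pp. 67–68) and III.2 (proof of Thm. 2.7, pp. 208–211). [Hartshorne1977]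
-/

open CategoryTheory Limits Opposite TopologicalSpace

universe u

namespace Literature.AlgebraicGeometry.Motives

variable {X : TopCat.{u}}

/-! ### Sections, monomorphisms, epimorphisms, zero objects -/

section Basic

variable {F G K : Sheaf (Opens.grothendieckTopology X) AddCommGrpCat.{u}}

/-- Composition of morphisms of sheaves, on elements of sections. [folklore] -/
theorem Sheaf.comp_hom_app_apply (f : F ⟶ G) (g : G ⟶ K) (U : (Opens X)ᵒᵖ) (x : F.obj.obj U) :
    (f ≫ g).hom.app U x = g.hom.app U (f.hom.app U x) := rfl

/-- A monomorphism of abelian sheaves is injective on sections. [folklore] -/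
theorem Sheaf.injective_of_mono (f : F ⟶ G) [Mono f] (U : (Opens X)ᵒᵖ) :
    Function.Injective (f.hom.app U) := by
  haveI : Mono f.hom := (sheafToPresheaf _ _).map_mono f
  haveI : Mono (f.hom.app U) := inferInstance
  exact (AddCommGrpCat.mono_iff_injective _).mp inferInstance

/-- A morphism of abelian sheaves which is bijective on all sections is an isomorphism.
[folklore] -/
theorem Sheaf.isIso_of_bijective (f : F ⟶ G) (hf : ∀ U, Function.Bijective (f.hom.app U)) :
    IsIso f := by
  haveI : ∀ U, IsIso (f.hom.app U) := fun U => by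
    haveI : IsIso ((forget AddCommGrpCat.{u}).map (f.hom.app U)) :=
      (isIso_iff_bijective _).mpr (hf U)
    exact isIso_of_reflects_iso _ (forget AddCommGrpCat.{u})
  haveI : IsIso ((sheafToPresheaf _ _).map f) := NatIso.isIso_of_isIso_app f.hom
  exact isIso_of_fully_faithful (sheafToPresheaf _ _) f

/-- An abelian sheaf all of whose sections vanish is a zero object. [folklore] -/
theorem Sheaf.isZero_of_sections (hF : ∀ (U : Opens X) (s : F.obj.obj (op U)), s = 0) :
    IsZero F := by
  have h : IsZero F.obj := by
    rw [IsZero.iff_id_eq_zero]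
    ext U s
    simpa using hF U.unop s
  exact IsZero.of_full_of_faithful_of_isZero (sheafToPresheaf _ _) F h

end Basic

/-! ### Sheaves supported on a subset -/

section Support

variable (F G K : Sheaf (Opens.grothendieckTopology X) AddCommGrpCat.{u})

/-- An abelian sheaf `F` on `X` is *supported on* the subset `Y ⊆ X` if its sections over
every open subset disjoint from `Y` vanish (for `Y` closed: `F|_{X ∖ Y} = 0`). The condition only
depends on the closure of `Y` (equivalently: `F` is supported on `closure Y`, i.e.
`Supp F ⊆ closure Y`); it is used below for closed `Y` only.
(Hartshorne II, Ex. 1.14, 1.19, 1.20.) [folklore] -/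
def IsSupportedOn (Y : Set X) : Prop :=
  ∀ (U : Opens X), Disjoint (U : Set X) Y → ∀ s : F.obj.obj (op U), s = 0

variable {F G K}

/-- A sheaf supported on `Y` is supported on any larger subset. [folklore] -/
theorem IsSupportedOn.mono {Y Y' : Set X} (h : IsSupportedOn F Y) (hY : Y ⊆ Y') :
    IsSupportedOn F Y' :=
  fun U hU s => h U (hU.mono_right hY) s

/-- A subsheaf of a sheaf supported on `Y` is supported on `Y`. [folklore] -/
theorem IsSupportedOn.of_mono {Y : Set X} (h : IsSupportedOn G Y) (f : F ⟶ G) [Mono f] :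
    IsSupportedOn F Y := fun U hU s =>
  Sheaf.injective_of_mono f (op U) (by rw [h U hU (f.hom.app (op U) s), map_zero])

/-- An epimorphism of abelian sheaves is locally surjective (elementwise form). [folklore] -/
theorem Sheaf.locally_surjective_of_epi (f : F ⟶ G) [Epi f] (U : Opens X) (t : G.obj.obj (op U))
    (x : X) (hx : x ∈ U) :
    ∃ (V : Opens X) (hV : V ≤ U), (∃ s, f.hom.app (op V) s = G.obj.map (homOfLE hV).op t) ∧
      x ∈ V := by
  have hf : TopCat.Presheaf.IsLocallySurjective f.hom :=
    (CategoryTheory.Sheaf.isLocallySurjective_iff_epi' AddCommGrpCat.{u} f).mpr inferInstance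
  rw [TopCat.Presheaf.isLocallySurjective_iff] at hf
  exact hf U t x hx

/-- A section of a sheaf which is locally zero is zero. [folklore] -/
theorem Sheaf.eq_zero_of_locally_eq_zero {U : Opens X} (s : F.obj.obj (op U))
    (h : ∀ x ∈ U, ∃ (V : Opens X) (_ : V ≤ U), x ∈ V ∧ ∀ (i : V ⟶ U), F.obj.map i.op s = 0) :
    s = 0 := by
  choose V hVU hxV hV using h
  refine TopCat.Sheaf.eq_of_locally_eq' (C := AddCommGrpCat.{u}) F (fun x : U => V x.1 x.2) U
    (fun x => homOfLE (hVU x.1 x.2)) (fun x hx => ?_) s 0 (fun x => ?_)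
  · exact Opens.mem_iSup.mpr ⟨⟨x, hx⟩, hxV x hx⟩
  · rw [map_zero]
    exact hV x.1 x.2 _

/-- A quotient of a sheaf supported on `Y` is supported on `Y`. [folklore] -/
theorem IsSupportedOn.of_epi {Y : Set X} (h : IsSupportedOn F Y) (f : F ⟶ G) [Epi f] :
    IsSupportedOn G Y := fun U hU s => by
  refine Sheaf.eq_zero_of_locally_eq_zero s fun x hx => ?_
  obtain ⟨V, hVU, ⟨t, ht⟩, hxV⟩ := Sheaf.locally_surjective_of_epi f U s x hx
  refine ⟨V, hVU, hxV, fun i => ?_⟩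
  rw [h V (hU.mono_left (by exact_mod_cast hVU)) t, map_zero] at ht
  rw [Subsingleton.elim i (homOfLE hVU)]
  exact ht.symm

/-- A sheaf supported on the empty set is zero. [folklore] -/
theorem IsSupportedOn.isZero (h : IsSupportedOn F ∅) : IsZero F :=
  Sheaf.isZero_of_sections fun U s => h U (Set.disjoint_empty _) s

/-- A sheaf of abelian groups has only the zero section over the empty open set. [folklore] -/
theorem Sheaf.eq_zero_of_eq_bot {U : Opens X} (hU : U = ⊥) (s : F.obj.obj (op U)) : s = 0 :=
  (AddCommGrpCat.subsingleton_of_isZero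
    ((TopCat.Sheaf.isTerminalOfEqEmpty (C := AddCommGrpCat.{u}) F hU).isZero)).elim _ _

/-- Every sheaf is supported on the whole space. [folklore] -/
theorem isSupportedOn_univ (F : Sheaf (Opens.grothendieckTopology X) AddCommGrpCat.{u}) :
    IsSupportedOn F Set.univ := fun U hU s =>
  Sheaf.eq_zero_of_eq_bot (by
    ext x
    simpa using fun hx => Set.disjoint_left.mp hU hx (Set.mem_univ x)) s

/-- The germs of the sections of a sheaf supported on a closed subset `Y` vanish outside `Y`.
[folklore] -/
theorem IsSupportedOn.germ_eq_zero {Y : Set X} (h : IsSupportedOn F Y) (hY : IsClosed Y)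
    {U : Opens X} (s : F.obj.obj (op U)) {x : X} (hx : x ∈ U) (hxY : x ∉ Y) :
    TopCat.Presheaf.germ F.obj U x hx s = 0 := by
  let W : Opens X := U ⊓ ⟨Yᶜ, hY.isOpen_compl⟩
  have hxW : x ∈ W := ⟨hx, hxY⟩
  have hW : Disjoint (W : Set X) Y := Set.disjoint_left.mpr fun y hy hy' =>
    (Opens.mem_inf.mp hy).2 hy'
  rw [← TopCat.Presheaf.germ_res_apply F.obj (homOfLE inf_le_left : W ⟶ U) x hxW,
    h W hW (F.obj.map (homOfLE inf_le_left : W ⟶ U).op s), map_zero]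

/-- In a complex `A ⟶ B ⟶ Q` of abelian sheaves with `B ⟶ Q` an epimorphism, if `A(W) → B(W)` is
onto for all opens `W ⊆ V`, then `Q(V) = 0`. [folklore] -/
theorem Sheaf.eq_zero_of_surjective (S : ShortComplex (Sheaf (Opens.grothendieckTopology X)
    AddCommGrpCat.{u})) [Epi S.g] (V : Opens X)
    (hV : ∀ W : Opens X, W ≤ V → Function.Surjective (S.f.hom.app (op W)))
    (s : S.X₃.obj.obj (op V)) : s = 0 := by
  refine Sheaf.eq_zero_of_locally_eq_zero s fun x hx => ?_
  obtain ⟨W, hWV, ⟨t, ht⟩, hxW⟩ := Sheaf.locally_surjective_of_epi S.g V s x hx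
  refine ⟨W, hWV, hxW, fun i => ?_⟩
  obtain ⟨a, rfl⟩ := hV W hWV t
  rw [← Sheaf.comp_hom_app_apply, S.zero] at ht
  rw [Subsingleton.elim i (homOfLE hWV), ← ht]
  rfl

end Support


/-- Two sections of an abelian sheaf with the same germs everywhere are equal (Mathlib's
`TopCat.Presheaf.section_ext`). [folklore] -/
theorem Sheaf.eq_of_germ_eq (G : Sheaf (Opens.grothendieckTopology X) AddCommGrpCat.{u})
    (U : Opens X) (s t : G.obj.obj (op U))
    (h : ∀ (x : X) (hx : x ∈ U), TopCat.Presheaf.germ G.obj U x hx s =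
      TopCat.Presheaf.germ G.obj U x hx t) : s = t :=
  TopCat.Presheaf.section_ext (C := AddCommGrpCat.{u}) G U s t h

/-! ### The subsheaf of sections whose germs vanish outside a subset -/

section SupportedPart

variable (G : Sheaf (Opens.grothendieckTopology X) AddCommGrpCat.{u}) (S : Set X)

/-- The subgroup of sections of `G` over `U` whose germs vanish at all points of `U` not in `S`.
[folklore] -/
noncomputable def supportedSections (U : Opens X) : AddSubgroup (G.obj.obj (op U)) where
  carrier := {s | ∀ (x : X) (hx : x ∈ U), x ∉ S → TopCat.Presheaf.germ G.obj U x hx s = 0}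
  zero_mem' x hx _ := by rw [map_zero]
  add_mem' {s t} hs ht x hx hxS := by rw [map_add, hs x hx hxS, ht x hx hxS, add_zero]
  neg_mem' {s} hs x hx hxS := by rw [map_neg, hs x hx hxS, neg_zero]

variable {G S} in
/-- Membership in `supportedSections` (definitional unfolding). [folklore] -/
theorem mem_supportedSections_iff {U : Opens X} (s : G.obj.obj (op U)) :
    s ∈ supportedSections G S U ↔ ∀ (x : X) (hx : x ∈ U), x ∉ S → TopCat.Presheaf.germ G.obj U x hx s = 0 :=
  Iff.rfl

variable {G S} in
/-- Restrictions of sections supported in `S` are supported in `S`. [folklore] -/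
theorem map_mem_supportedSections {U V : Opens X} (i : V ⟶ U) {s : G.obj.obj (op U)}
    (hs : s ∈ supportedSections G S U) : G.obj.map i.op s ∈ supportedSections G S V :=
  fun x hx hxS => by rw [TopCat.Presheaf.germ_res_apply]; exact hs x (i.le hx) hxS

/-- The presheaf `U ↦ {s ∈ G(U) | germ_x s = 0 for all x ∈ U ∖ S}` of sections of `G` supported
in `S` (for `S` open this is Hartshorne's `G_S = j_!(G|_S)`, II Ex. 1.19(b); for `S` closed it is
the subsheaf `ℋ⁰_S(G)` of sections with support in `S`, II Ex. 1.20). [folklore] -/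
noncomputable def supportedPartPresheaf : TopCat.Presheaf AddCommGrpCat.{u} X where
  obj U := AddCommGrpCat.of (supportedSections G S U.unop)
  map {U V} i := AddCommGrpCat.ofHom
    { toFun := fun s => ⟨G.obj.map i s.1, map_mem_supportedSections i.unop s.2⟩
      map_zero' := Subtype.ext (by simp)
      map_add' := fun _ _ => Subtype.ext (by simp) }
  map_id U := by
    ext s
    simp
  map_comp {U V W} i j := by
    ext s
    simp

/-- The inclusion of the presheaf of sections supported in `S` into `G`. [folklore] -/
noncomputable def supportedPartPresheafι : supportedPartPresheaf G S ⟶ G.obj where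
  app U := AddCommGrpCat.ofHom (AddSubgroup.subtype _)
  naturality U V i := by
    ext s
    rfl

/-- The inclusion `G_S ⟶ G` on sections is the subtype inclusion. [folklore] -/
theorem supportedPartPresheafι_app_apply (U : (Opens X)ᵒᵖ) (s : (supportedPartPresheaf G S).obj U) :
    (supportedPartPresheafι G S).app U s = s.1 := rfl

/-- The inclusion `G_S(U) ⟶ G(U)` is injective. [folklore] -/
theorem injective_supportedPartPresheafι_app (U : (Opens X)ᵒᵖ) :
    Function.Injective ((supportedPartPresheafι G S).app U) :=
  fun _ _ h => Subtype.ext h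

/-- The presheaf of sections supported in `S` is a sheaf (the condition on germs is local).
[folklore] -/
theorem isSheaf_supportedPartPresheaf : (supportedPartPresheaf G S).IsSheaf := by
  rw [TopCat.Presheaf.isSheaf_iff_isSheafUniqueGluing]
  intro ι U sf hsf
  -- glue the underlying sections in `G`
  have hsf' : TopCat.Presheaf.IsCompatible G.obj U fun i => (sf i).1 := fun i j =>
    congr_arg Subtype.val (hsf i j)
  obtain ⟨s, hs, hs'⟩ := TopCat.Sheaf.existsUnique_gluing (C := AddCommGrpCat.{u}) G U _ hsf'
  have hsmem : s ∈ supportedSections G S (iSup U) := fun x hx hxS => by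
    obtain ⟨i, hi⟩ := Opens.mem_iSup.mp hx
    rw [← TopCat.Presheaf.germ_res_apply G.obj (Opens.leSupr U i) x hi, hs i]
    exact (sf i).2 x hi hxS
  refine ⟨⟨s, hsmem⟩, fun i => Subtype.ext (hs i), fun t ht => Subtype.ext (hs' t.1 fun i => ?_)⟩
  exact congr_arg Subtype.val (ht i)

/-- The subsheaf `G_S ⊆ G` of sections supported in `S` (sections whose germs vanish at the points
not in `S`). [folklore] -/
noncomputable def supportedPart : Sheaf (Opens.grothendieckTopology X) AddCommGrpCat.{u} :=
  ⟨supportedPartPresheaf G S, isSheaf_supportedPartPresheaf G S⟩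

/-- The inclusion `G_S ⟶ G`. [folklore] -/
noncomputable def supportedPartι : supportedPart G S ⟶ G := ⟨supportedPartPresheafι G S⟩

/-- The inclusion `G_S ⟶ G` is a monomorphism. [folklore] -/
instance mono_supportedPartι : Mono (supportedPartι G S) :=
  Sheaf.mono_of_injective _ (injective_supportedPartPresheafι_app G S)

/-- The inclusion `G_S ⟶ G` on sections is the subtype inclusion. [folklore] -/
theorem supportedPartι_app_apply (U : (Opens X)ᵒᵖ) (s : (supportedPart G S).obj.obj U) :
    (supportedPartι G S).hom.app U s = s.1 := rfl

/-- Over opens contained in `S`, every section of `G` is supported in `S`. [folklore] -/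
theorem surjective_supportedPartι_app {U : Opens X} (hU : (U : Set X) ⊆ S) :
    Function.Surjective ((supportedPartι G S).hom.app (op U)) :=
  fun s => ⟨⟨s, fun _ hx hxS => absurd (hU hx) hxS⟩, rfl⟩

/-- `G_S` is supported on `S` (unconditionally: a section of `G_S` over an open disjoint from `S`
has all its germs zero). [folklore] -/
theorem isSupportedOn_supportedPart_self : IsSupportedOn (supportedPart G S) S := by
  intro U hU s
  apply Subtype.ext
  change s.1 = 0
  exact Sheaf.eq_of_germ_eq G U s.1 0 fun x hx =>
    (s.2 x hx (Set.disjoint_left.mp hU hx)).trans (map_zero _).symm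

/-- If `G` is supported on the closed subset `Y'`, then `G_S` is supported on any subset `Y`
containing `S ∩ Y'` (a section of `G_S` has vanishing germs off `S` by definition, and off `Y'`
because `G` vanishes on the open `X ∖ Y'`). [folklore] -/
theorem isSupportedOn_supportedPart {Y Y' : Set X} (hG : IsSupportedOn G Y') (hY' : IsClosed Y')
    (hSY : S ∩ Y' ⊆ Y) : IsSupportedOn (supportedPart G S) Y := by
  intro U hU s
  apply Subtype.ext
  change s.1 = 0
  refine Sheaf.eq_of_germ_eq G U s.1 0 fun x hx => Eq.trans ?_ (map_zero _).symm
  by_cases hxS : x ∈ S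
  · exact hG.germ_eq_zero hY' s.1 hx fun h => Set.disjoint_left.mp hU hx (hSY ⟨hxS, h⟩)
  · exact s.2 x hx hxS

/-- If `G` is supported on the closed subset `Y` and `U ∩ Y ⊆ S`, every section of `G` over `U`
is supported in `S`: `G_S(U) = G(U)`. [folklore] -/
theorem surjective_supportedPartι_app_of_isSupportedOn {Y : Set X} (hG : IsSupportedOn G Y)
    (hY : IsClosed Y) {U : Opens X} (hU : (U : Set X) ∩ Y ⊆ S) :
    Function.Surjective ((supportedPartι G S).hom.app (op U)) :=
  fun s => ⟨⟨s, fun _ hx hxS => hG.germ_eq_zero hY s hx fun hxY => hxS (hU ⟨hx, hxY⟩)⟩, rfl⟩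

end SupportedPart

/-! ### Extension by zero of sections of a sheaf supported on a closed subset -/

section Extension

variable {G : Sheaf (Opens.grothendieckTopology X) AddCommGrpCat.{u}}

/-- A sheaf supported on a closed subset `Y` has its sections extend (by zero) from `V` to
`V ∪ (X ∖ Y)`: the restriction map `G(V ∪ (X ∖ Y)) → G(V)` is surjective (`X ∖ Y` is the open
`(⟨Y, hY⟩ : Closeds X).compl`). [folklore] -/
theorem IsSupportedOn.surjective_map_of_isClosed {Y : Set X} (hG : IsSupportedOn G Y)
    (hY : IsClosed Y) (V : Opens X) :
    Function.Surjective
      (G.obj.map (homOfLE (le_sup_left : V ≤ V ⊔ (⟨Y, hY⟩ : Closeds X).compl)).op) := by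
  intro t
  have hV : Disjoint ((V ⊓ (⟨Y, hY⟩ : Closeds X).compl : Opens X) : Set X) Y :=
    Set.disjoint_left.mpr fun y hy hy' => (Opens.mem_inf.mp hy).2 hy'
  obtain ⟨w, hw, -⟩ := exists_glue₂ G V (⟨Y, hY⟩ : Closeds X).compl t 0 (by
    rw [map_zero]
    exact hG _ hV _)
  exact ⟨w, hw⟩

end Extension

/-! ### The sheaves `ℤ_{Y,U}`: the constant sheaf `ℤ` of an irreducible closed subset `Y`,
restricted to the open `U ⊇ X ∖ Y` and extended by zero -/

section ConstSub

open Classical in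
/-- The sections over `V` of `ℤ_{Y,U}`: the group `ℤ` (as `ULift ℤ`) if `V ⊆ U` and `V` meets
`Y`, and `0` otherwise (realised as a subgroup of `ULift ℤ`). [folklore] -/
def constSubSections (Y : Set X) (U V : Opens X) : AddSubgroup (ULift.{u} ℤ) where
  carrier := {n | (V ≤ U ∧ ((V : Set X) ∩ Y).Nonempty) ∨ n = 0}
  zero_mem' := Or.inr rfl
  add_mem' {a b} ha hb := by
    rcases ha with ha | rfl
    · exact Or.inl ha
    · simpa using hb
  neg_mem' {a} ha := by
    rcases ha with ha | rfl
    · exact Or.inl ha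
    · exact Or.inr neg_zero

variable (Y : Set X) (U : Opens X)

/-- Membership in `constSubSections` (definitional unfolding). [folklore] -/
theorem mem_constSubSections_iff {V : Opens X} (n : ULift.{u} ℤ) :
    n ∈ constSubSections Y U V ↔ (V ≤ U ∧ ((V : Set X) ∩ Y).Nonempty) ∨ n = 0 := Iff.rfl

variable {Y U} in
/-- Sections of `ℤ_{Y,U}` over an open not contained in `U` or not meeting `Y` vanish. [folklore] -/
theorem constSubSections.eq_zero {V : Opens X} (n : constSubSections Y U V)
    (h : ¬ (V ≤ U ∧ ((V : Set X) ∩ Y).Nonempty)) : n = 0 :=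
  Subtype.ext ((n.2.resolve_left h).trans rfl)

variable {Y U} in
/-- Sections of `ℤ_{Y,U}` over an open not meeting `Y` vanish. [folklore] -/
theorem constSubSections.eq_zero_of_not_nonempty {V : Opens X} (n : constSubSections Y U V)
    (h : ¬ ((V : Set X) ∩ Y).Nonempty) : n = 0 :=
  constSubSections.eq_zero n fun h' => h h'.2

variable {Y U} in
/-- Sections of `ℤ_{Y,U}` over an open not contained in `U` vanish. [folklore] -/
theorem constSubSections.eq_zero_of_not_le {V : Opens X} (n : constSubSections Y U V)
    (h : ¬ V ≤ U) : n = 0 :=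
  constSubSections.eq_zero n fun h' => h h'.1

open Classical in
/-- The restriction maps of `ℤ_{Y,U}`: the identity of `ℤ` when the smaller open still meets `Y`,
zero otherwise. [folklore] -/
noncomputable def constSubRes {V W : Opens X} (h : W ≤ V) :
    constSubSections Y U V →+ constSubSections Y U W where
  toFun n := ⟨if ((W : Set X) ∩ Y).Nonempty then n.1 else 0, by
    by_cases hW : ((W : Set X) ∩ Y).Nonempty
    · rw [if_pos hW]
      rcases n.2 with hc | h0
      · exact Or.inl ⟨h.trans hc.1, hW⟩
      · exact Or.inr h0
    · rw [if_neg hW]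
      exact Or.inr rfl⟩
  map_zero' := Subtype.ext (by simp)
  map_add' a b := Subtype.ext (by
    by_cases hW : ((W : Set X) ∩ Y).Nonempty <;> simp [hW])

open Classical in
/-- The value of a restricted section of `ℤ_{Y,U}`. [folklore] -/
theorem constSubRes_apply_coe {V W : Opens X} (h : W ≤ V) (n : constSubSections Y U V) :
    (constSubRes Y U h n).1 = if ((W : Set X) ∩ Y).Nonempty then n.1 else 0 := rfl

/-- Restriction to a smaller open meeting `Y` preserves the value of a section of `ℤ_{Y,U}`.
[folklore] -/
theorem constSubRes_apply_coe_of_nonempty {V W : Opens X} (h : W ≤ V)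
    (hW : ((W : Set X) ∩ Y).Nonempty) (n : constSubSections Y U V) :
    (constSubRes Y U h n).1 = n.1 := by
  rw [constSubRes_apply_coe, if_pos hW]

/-- The presheaf `ℤ_{Y,U}`: `V ↦ ℤ` if `V ⊆ U` meets `Y`, `0` otherwise. [folklore] -/
noncomputable def constSubPresheaf : TopCat.Presheaf AddCommGrpCat.{u} X where
  obj V := AddCommGrpCat.of (constSubSections Y U V.unop)
  map {V W} i := AddCommGrpCat.ofHom (constSubRes Y U i.unop.le)
  map_id V := by
    refine AddCommGrpCat.hom_ext (AddMonoidHom.ext fun n => Subtype.ext ?_)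
    change (constSubRes Y U le_rfl n).1 = n.1
    rw [constSubRes_apply_coe]
    split_ifs with h
    · rfl
    · exact congr_arg Subtype.val (constSubSections.eq_zero_of_not_nonempty n h).symm
  map_comp {V W W'} i j := by
    refine AddCommGrpCat.hom_ext (AddMonoidHom.ext fun n => Subtype.ext ?_)
    change (constSubRes Y U (i ≫ j).unop.le n).1 =
      (constSubRes Y U j.unop.le (constSubRes Y U i.unop.le n)).1
    simp only [constSubRes_apply_coe]
    split_ifs with h₁ h₂
    · rfl
    · exact absurd (h₁.mono (Set.inter_subset_inter_left _ (j.unop.le))) h₂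
    · rfl

/-- The sections of the presheaf `ℤ_{Y,U}` (definitional unfolding). [folklore] -/
@[simp] theorem constSubPresheaf_obj (V : (Opens X)ᵒᵖ) :
    (constSubPresheaf Y U).obj V = AddCommGrpCat.of (constSubSections Y U V.unop) := rfl

/-- The restriction maps of the presheaf `ℤ_{Y,U}` (definitional unfolding). [folklore] -/
theorem constSubPresheaf_map_apply_coe {V W : Opens X} (i : W ⟶ V)
    (n : (constSubPresheaf Y U).obj (op V)) :
    ((constSubPresheaf Y U).map i.op n).1 = (constSubRes Y U i.le n).1 := rfl

variable {Y U}

/-- Two opens meeting a preirreducible set meet each other inside it. [folklore] -/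
theorem IsPreirreducible.inter_inter_nonempty (hY : IsPreirreducible Y) (V W : Opens X)
    (hV : ((V : Set X) ∩ Y).Nonempty) (hW : ((W : Set X) ∩ Y).Nonempty) :
    ((V : Set X) ∩ W ∩ Y).Nonempty := by
  have := hY V W V.2 W.2 (by rwa [Set.inter_comm]) (by rwa [Set.inter_comm])
  rwa [Set.inter_comm] at this

/-- `ℤ_{Y,U}` is a sheaf when `Y` is (pre)irreducible and `U ⊇ X ∖ Y`. [folklore] -/
theorem isSheaf_constSubPresheaf (hY : IsPreirreducible Y) (hU : Yᶜ ⊆ (U : Set X)) :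
    (constSubPresheaf Y U).IsSheaf := by
  classical
  rw [TopCat.Presheaf.isSheaf_iff_isSheafUniqueGluing]
  intro ι V sf hsf
  -- values of the local sections and their compatibility
  have hcompat : ∀ i j, ((V i : Set X) ∩ (V j) ∩ Y).Nonempty → (sf i).1 = (sf j).1 := by
    intro i j hij
    have h := congr_arg Subtype.val (hsf i j)
    have hij' : (((V i ⊓ V j : Opens X) : Set X) ∩ Y).Nonempty := by
      rwa [Opens.coe_inf]
    rw [constSubPresheaf_map_apply_coe, constSubPresheaf_map_apply_coe,
      constSubRes_apply_coe_of_nonempty _ _ _ hij',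
      constSubRes_apply_coe_of_nonempty _ _ _ hij'] at h
    exact h
  have hval : ∀ i, ¬ (V i ≤ U ∧ ((V i : Set X) ∩ Y).Nonempty) → (sf i).1 = 0 := fun i hi =>
    congr_arg Subtype.val (constSubSections.eq_zero (sf i) hi)
  by_cases hex : ∃ i, ((V i : Set X) ∩ Y).Nonempty
  · obtain ⟨i₀, hi₀⟩ := hex
    -- every `V j` is contained in `U` unless the glued value vanishes
    have hmem : (sf i₀).1 ∈ constSubSections Y U (iSup V) := by
      by_cases h0 : (sf i₀).1 = 0
      · exact Or.inr h0
      refine Or.inl ⟨?_, hi₀.mono (Set.inter_subset_inter_left _ ?_)⟩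
      · intro x hx
        obtain ⟨j, hj⟩ := Opens.mem_iSup.mp hx
        by_contra hxU
        have hxY : x ∈ Y := by
          by_contra hxY
          exact hxU (hU hxY)
        have hVjU : ¬ (V j ≤ U) := fun h => hxU (h hj)
        have hij := IsPreirreducible.inter_inter_nonempty hY (V i₀) (V j) hi₀ ⟨x, hj, hxY⟩
        exact h0 ((hcompat i₀ j hij).trans (hval j fun h => hVjU h.1))
      · exact (le_iSup V i₀ : V i₀ ≤ iSup V)
    refine ⟨⟨(sf i₀).1, hmem⟩, fun i => Subtype.ext ?_, fun t ht => Subtype.ext ?_⟩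
    · change (constSubRes Y U (le_iSup V i : V i ≤ iSup V) ⟨(sf i₀).1, hmem⟩).1 = (sf i).1
      rw [constSubRes_apply_coe]
      split_ifs with hi
      · exact hcompat _ _ (IsPreirreducible.inter_inter_nonempty hY (V i₀) (V i) hi₀ hi)
      · exact (hval i fun h => hi h.2).symm
    · have h := congr_arg Subtype.val (ht i₀)
      change (constSubRes Y U (le_iSup V i₀ : V i₀ ≤ iSup V) t).1 = (sf i₀).1 at h
      rwa [constSubRes_apply_coe_of_nonempty _ _ _ hi₀] at h
  · have hex' : ∀ i, ¬ ((V i : Set X) ∩ Y).Nonempty := fun i hi => hex ⟨i, hi⟩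
    have hsup : ¬ (((iSup V : Opens X) : Set X) ∩ Y).Nonempty := by
      rintro ⟨x, hx, hxY⟩
      rw [Opens.coe_iSup, Set.mem_iUnion] at hx
      obtain ⟨i, hi⟩ := hx
      exact hex' i ⟨x, hi, hxY⟩
    refine ⟨0, fun i => ?_, fun t _ => constSubSections.eq_zero_of_not_nonempty t hsup⟩
    rw [map_zero]
    exact (constSubSections.eq_zero_of_not_nonempty (sf i) (hex' i)).symm

/-- The sheaf `ℤ_{Y,U}` on `X`, for `Y ⊆ X` (pre)irreducible and `U ⊇ X ∖ Y` open: sections `ℤ`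
over the opens `V ⊆ U` meeting `Y` and `0` over all other opens. For `Y` closed irreducible with
inclusion `j : Y → X` this is `j_*((ℤ_Y)_{U ∩ Y})`, the constant sheaf `ℤ` on `Y` restricted to
the open subset `U ∩ Y` and extended by zero (Hartshorne's `ℤ_U` on the space `Y`, proof of
III.2.7), pushed forward to `X`. [folklore] -/
noncomputable def constSub (hY : IsPreirreducible Y) (hU : Yᶜ ⊆ (U : Set X)) :
    Sheaf (Opens.grothendieckTopology X) AddCommGrpCat.{u} :=
  ⟨constSubPresheaf Y U, isSheaf_constSubPresheaf hY hU⟩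

/-- The underlying presheaf of `ℤ_{Y,U}` (definitional unfolding). [folklore] -/
@[simp] theorem constSub_obj (hY : IsPreirreducible Y) (hU : Yᶜ ⊆ (U : Set X)) :
    (constSub hY hU).obj = constSubPresheaf Y U := rfl

/-- `ℤ_{Y,U}` is supported on `Y`. [folklore] -/
theorem isSupportedOn_constSub (hY : IsPreirreducible Y) (hU : Yᶜ ⊆ (U : Set X)) :
    IsSupportedOn (constSub hY hU) Y := fun V hV n =>
  constSubSections.eq_zero_of_not_nonempty n (by
    rw [Set.not_nonempty_iff_eq_empty]
    exact hV.inter_eq)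

/-- `ℤ_{Y,X}` (the constant sheaf of the irreducible subset `Y`, pushed forward to `X`) is
flasque. [folklore] -/
theorem isFlasque_constSub_top (hY : IsPreirreducible Y) (hU : Yᶜ ⊆ ((⊤ : Opens X) : Set X)) :
    TopCat.Sheaf.IsFlasque (constSub hY hU) where
  epi {V W} i := by
    rw [AddCommGrpCat.epi_iff_surjective]
    intro n
    by_cases hW : ((W.unop : Set X) ∩ Y).Nonempty
    · refine ⟨⟨n.1, ?_⟩, Subtype.ext ?_⟩
      · rcases n.2 with h | h
        · exact Or.inl ⟨le_top, h.2.mono (Set.inter_subset_inter_left _ i.unop.le)⟩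
        · exact Or.inr h
      · change (constSubRes Y ⊤ i.unop.le _).1 = n.1
        rw [constSubRes_apply_coe_of_nonempty _ _ _ hW]
    · exact ⟨0, by rw [map_zero]; exact (constSubSections.eq_zero_of_not_nonempty n hW).symm⟩

/-- `ℤ_{Y,U} = 0` if `U` does not meet `Y`. [folklore] -/
theorem isZero_constSub (hY : IsPreirreducible Y) (hU : Yᶜ ⊆ (U : Set X))
    (hUY : (U : Set X) ∩ Y = ∅) : IsZero (constSub hY hU) :=
  Sheaf.isZero_of_sections fun _ n => constSubSections.eq_zero n fun h =>
    Set.not_nonempty_iff_eq_empty.mpr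
      (Set.eq_empty_of_subset_empty (hUY ▸ Set.inter_subset_inter_left _ h.1)) h.2

end ConstSub

section ConstSubMaps

variable {Y : Set X} {U U' : Opens X} (hY : IsPreirreducible Y) (hU : Yᶜ ⊆ (U : Set X))
  (hU' : Yᶜ ⊆ (U' : Set X))

/-- Sections of `ℤ_{Y,U}` are determined by their value in `ℤ`. [folklore] -/
theorem constSubSections.ext {V : Opens X} {n m : constSubSections Y U V}
    (h : n.1.down = m.1.down) : n = m :=
  Subtype.ext (ULift.ext _ _ h)

/-- The section `1 ∈ ℤ = ℤ_{Y,U}(V)` over an open `V ⊆ U` meeting `Y`. [folklore] -/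
def constSubOne {V : Opens X} (hV : V ≤ U) (hVY : ((V : Set X) ∩ Y).Nonempty) :
    constSubSections Y U V :=
  ⟨⟨1⟩, Or.inl ⟨hV, hVY⟩⟩

/-- The value of the section `1` is `1`. [folklore] -/
@[simp] theorem constSubOne_coe_down {V : Opens X} (hV : V ≤ U) (hVY : ((V : Set X) ∩ Y).Nonempty) :
    (constSubOne hV hVY).1.down = 1 := rfl

/-- The value of `k • n` is `k` times the value of `n`. [folklore] -/
theorem constSubSections.coe_zsmul_down {V : Opens X} (k : ℤ) (n : constSubSections Y U V) :
    (k • n).1.down = k * n.1.down := by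
  simp

/-- Every section of `ℤ_{Y,U}` over an open `V ⊆ U` meeting `Y` is a multiple of `1`. [folklore] -/
theorem constSubSections.eq_zsmul_one {V : Opens X} (hV : V ≤ U)
    (hVY : ((V : Set X) ∩ Y).Nonempty) (n : constSubSections Y U V) :
    n = n.1.down • constSubOne hV hVY :=
  constSubSections.ext (by rw [constSubSections.coe_zsmul_down, constSubOne_coe_down, mul_one])

/-- The inclusion `ℤ_{Y,U} ⟶ ℤ_{Y,U'}` for `U ⊆ U'`. [folklore] -/
noncomputable def constSubι (h : U ≤ U') : constSub hY hU ⟶ constSub hY hU' where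
  hom :=
    { app := fun V => AddCommGrpCat.ofHom
        { toFun := fun n => ⟨n.1, n.2.imp_left fun hn => ⟨hn.1.trans h, hn.2⟩⟩
          map_zero' := rfl
          map_add' := fun _ _ => rfl }
      naturality := fun V W i => by
        refine AddCommGrpCat.hom_ext (AddMonoidHom.ext fun n => Subtype.ext ?_)
        change (constSubRes Y U i.unop.le n).1 = (constSubRes Y U' i.unop.le _).1
        simp only [constSubRes_apply_coe]
        split_ifs <;> rfl }

/-- The inclusion `ℤ_{Y,U} ⟶ ℤ_{Y,U'}` preserves the values of sections. [folklore] -/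
@[simp] theorem constSubι_app_apply_coe (h : U ≤ U') (V : (Opens X)ᵒᵖ)
    (n : (constSub hY hU).obj.obj V) : ((constSubι hY hU hU' h).hom.app V n).1 = n.1 := rfl

/-- The inclusion `ℤ_{Y,U} ⟶ ℤ_{Y,U'}` is a monomorphism. [folklore] -/
instance mono_constSubι (h : U ≤ U') : Mono (constSubι hY hU hU' h) :=
  Sheaf.mono_of_injective _ fun V n m hnm => by
    have e := congr_arg Subtype.val hnm
    exact Subtype.ext e

/-- Over opens `W ⊆ U`, `ℤ_{Y,U}(W) → ℤ_{Y,U'}(W)` is onto. [folklore] -/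
theorem surjective_constSubι_app (h : U ≤ U') {W : Opens X} (hW : W ≤ U) :
    Function.Surjective ((constSubι hY hU hU' h).hom.app (op W)) := fun m =>
  ⟨⟨m.1, m.2.imp_left fun hm => ⟨hW, hm.2⟩⟩, rfl⟩

/-- The cokernel `ℤ_{Y,U'}/ℤ_{Y,U}` is supported on `Y ∖ U`. [folklore] -/
theorem isSupportedOn_cokernel_constSubι (h : U ≤ U') :
    IsSupportedOn (cokernel (constSubι hY hU hU' h)) (Y ∩ (U : Set X)ᶜ) := by
  intro V hV s
  apply Sheaf.eq_zero_of_surjective (X := X) (ShortComplex.cokernelSequence (constSubι hY hU hU' h)) V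
  intro W hWV
  refine surjective_constSubι_app hY hU hU' h fun x hx => ?_
  by_contra hxU
  have hxY : x ∈ Y := by
    by_contra hxY
    exact hxU (hU hxY)
  exact Set.disjoint_left.mp hV (hWV hx) ⟨hxY, hxU⟩

variable {G : Sheaf (Opens.grothendieckTopology X) AddCommGrpCat.{u}}

open Classical in
/-- The components of the morphism `ℤ_{Y,U} ⟶ G` defined by a section `s ∈ G(U)`:
`n ↦ n • s|_V` over `V ⊆ U`, zero otherwise. [folklore] -/
noncomputable def constSubDescApp (s : G.obj.obj (op U)) (V : Opens X) :
    constSubSections Y U V →+ G.obj.obj (op V) where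
  toFun n := if h : V ≤ U then n.1.down • G.obj.map (homOfLE h).op s else 0
  map_zero' := by
    split_ifs <;> simp
  map_add' a b := by
    split_ifs
    · rw [← add_zsmul]
      rfl
    · rw [add_zero]

/-- The components of `ℤ_{Y,U} ⟶ G` over opens `V ⊆ U`. [folklore] -/
theorem constSubDescApp_apply_of_le (s : G.obj.obj (op U)) {V : Opens X} (h : V ≤ U)
    (n : constSubSections Y U V) :
    constSubDescApp s V n = n.1.down • G.obj.map (homOfLE h).op s := by
  rw [constSubDescApp, AddMonoidHom.coe_mk, ZeroHom.coe_mk, dif_pos h]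

/-- The components of `ℤ_{Y,U} ⟶ G` over opens `V ⊄ U` vanish. [folklore] -/
theorem constSubDescApp_apply_of_not_le (s : G.obj.obj (op U)) {V : Opens X} (h : ¬ V ≤ U)
    (n : constSubSections Y U V) : constSubDescApp s V n = 0 := by
  rw [constSubDescApp, AddMonoidHom.coe_mk, ZeroHom.coe_mk, dif_neg h]

/-- The morphism `ℤ_{Y,U} ⟶ G` defined by a section `s ∈ G(U)` of a sheaf `G` supported on `Y`
(`1 ↦ s`). [folklore] -/
noncomputable def constSubDesc (hG : IsSupportedOn G Y) (s : G.obj.obj (op U)) :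
    constSub hY hU ⟶ G where
  hom :=
    { app := fun V => AddCommGrpCat.ofHom (constSubDescApp s V.unop)
      naturality := fun V W i => by
        refine AddCommGrpCat.hom_ext (AddMonoidHom.ext fun n => ?_)
        change constSubDescApp s W.unop (constSubRes Y U i.unop.le n) =
          G.obj.map i (constSubDescApp s V.unop n)
        by_cases hV : V.unop ≤ U
        · have hW : W.unop ≤ U := i.unop.le.trans hV
          rw [constSubDescApp_apply_of_le s hV, constSubDescApp_apply_of_le s hW, map_zsmul,
            constSubRes_apply_coe]
          have e : G.obj.map i (G.obj.map (homOfLE hV).op s) = G.obj.map (homOfLE hW).op s := by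
            rw [← ConcreteCategory.comp_apply, ← Functor.map_comp]
            rfl
          rw [e]
          split_ifs with hWY
          · rfl
          · rw [hG W.unop (Set.disjoint_iff_inter_eq_empty.mpr
              (Set.not_nonempty_iff_eq_empty.mp hWY)) (G.obj.map (homOfLE hW).op s),
              smul_zero, smul_zero]
        · have hn : n = 0 := constSubSections.eq_zero_of_not_le n hV
          subst hn
          change constSubDescApp s W.unop (constSubRes Y U i.unop.le
              (0 : constSubSections Y U V.unop)) =
            G.obj.map i (constSubDescApp s V.unop (0 : constSubSections Y U V.unop))
          rw [map_zero, map_zero, map_zero, map_zero] }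

/-- The morphism `ℤ_{Y,U} ⟶ G` defined by `s` is `n ↦ n • s|_V` over opens `V ⊆ U`. [folklore] -/
theorem constSubDesc_app_apply (hG : IsSupportedOn G Y) (s : G.obj.obj (op U)) {V : Opens X}
    (h : V ≤ U) (n : (constSub hY hU).obj.obj (op V)) :
    (constSubDesc hY hU hG s).hom.app (op V) n = n.1.down • G.obj.map (homOfLE h).op s :=
  constSubDescApp_apply_of_le s h n

/-- The morphism `ℤ_{Y,U} ⟶ G` defined by `s` vanishes over opens `V ⊄ U`. [folklore] -/
theorem constSubDesc_app_apply_of_not_le (hG : IsSupportedOn G Y) (s : G.obj.obj (op U))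
    {V : Opens X} (h : ¬ V ≤ U) (n : (constSub hY hU).obj.obj (op V)) :
    (constSubDesc hY hU hG s).hom.app (op V) n = 0 :=
  constSubDescApp_apply_of_not_le s h n

/-- The morphism `ℤ_{Y,U} ⟶ G` defined by `s ∈ G(U)` sends `1 ∈ ℤ_{Y,U}(U)` to `s`. [folklore] -/
theorem constSubDesc_app_one (hG : IsSupportedOn G Y) (s : G.obj.obj (op U))
    (hUY : ((U : Set X) ∩ Y).Nonempty) :
    (constSubDesc hY hU hG s).hom.app (op U) (constSubOne le_rfl hUY) = s := by
  rw [constSubDesc_app_apply hY hU hG s le_rfl, constSubOne_coe_down, one_zsmul]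
  have : (homOfLE (le_refl U)).op = 𝟙 (op U) := rfl
  rw [this, G.obj.map_id]
  rfl

end ConstSubMaps

end Literature.AlgebraicGeometry.Motives
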